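import Summits.KontsevichZagierPeriods.KontsevichZagierPeriods.Theorems.RealPeriodSectorComplete.Negative.Data

/-!
# `RealPeriodSectorComplete` (stmt-KontsevichZagierPeriods-5381) — negative knowledge, part 1: load-bearing hypotheses, the diagonal, the cusp

* §2 LOAD-BEARING ANALYSIS: `RealPeriodSectorCompleteWithoutValueEq` (the crux verbatim without
  `r.value = r'.value`) is FALSE (`realPeriodSectorComplete_false_without_valueEq`, witness
  `fermatRep 1` vs `fermatRep 2`); the positivity hypotheses `0 < a`, `0 < b` are NOT
  load-bearing: `realPeriodSectorComplete_iff_withoutPos` — the crux is EQUIVALENT to its version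
  over all rational coefficients (the value has the sign of the coefficient: `value_pos`,
  `value_eq_zero`, `value_neg_of_neg`; zero coefficients give relations; negative ones are the
  positive case for the negated representations).
* §3 TIGHTNESS: on one curve the KZ-classes are exactly the coefficients
  (`equivalent_fermatRep_iff`), and the DIAGONAL `(A,B) = (A′,B′)` of the crux is a theorem in one
  integrand-additivity move (`realPeriodSectorComplete_diag`): the content of the crux is entirely
  off-diagonal.
* §5 THE DISCRIMINANT HYPOTHESIS at its most degenerate excluded instance: the cusp `A = B = 0` is
  VACUOUS (`no_rep_cusp`: `a·x^{-3/2}` is not integrable on `(0, ∞)`), so dropping `4A³+27B² ≠ 0`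
  adds nothing there.

General-purpose by-products: `of_mem_relations_of_eqOn_zero`, `of_add_of_neg_mem_relations`,
`equivalent_neg_iff`, `equivalent_of_eqOn` (zero / negation bookkeeping in `KZ.relations`).
[cite: KontsevichZagier2001, §1.2 Conjecture 1]
-/

noncomputable section

open MeasureTheory Set Filter MvPolynomial
open Literature.ModelTheory.ExponentialFields (IsSemialgebraic isSemialgebraic_setOf_eval_pos
  isSemialgebraic_setOf_eval_eq_zero)
open Literature.NumberTheory.Transcendental
open Literature.NumberTheory.Transcendental.KZ

namespace Summit.KontsevichZagierPeriods.IsogenyCertificates.RealPeriodSectorCompleteNegative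

open Summit.KontsevichZagierPeriods.KontsevichZagierPeriods.Theses.IsogenyCertificates
  (RealPeriodSectorComplete)

/-- `ℝ¹ ≃ ℝ` is evaluation at `0`. [folklore] -/
theorem funUnique_apply_eq (x : Fin 1 → ℝ) : MeasurableEquiv.funUnique (Fin 1) ℝ x = x 0 := rfl

/-! ## §2 Load-bearing analysis of the hypotheses -/

/-! ### (2a) `r.value = r'.value` IS load-bearing -/

/-- The crux with the value-equality hypothesis DROPPED ("all real-sector representations are
KZ-equivalent"). -/
def RealPeriodSectorCompleteWithoutValueEq : Prop :=
  ∀ (A B A' B' : ℤ), 4 * A ^ 3 + 27 * B ^ 2 ≠ 0 → 4 * A' ^ 3 + 27 * B' ^ 2 ≠ 0 → ∀ (a b : ℚ),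
    0 < a → 0 < b → ∀ (r r' : IntegralRep 1),
    r.domain = {x | 0 < x 0 ^ 3 + (A : ℝ) * x 0 + (B : ℝ)} →
    EqOn r.integrand (fun x => (a : ℝ) / Real.sqrt (x 0 ^ 3 + (A : ℝ) * x 0 + (B : ℝ))) r.domain →
    r'.domain = {x | 0 < x 0 ^ 3 + (A' : ℝ) * x 0 + (B' : ℝ)} →
    EqOn r'.integrand (fun x => (b : ℝ) / Real.sqrt (x 0 ^ 3 + (A' : ℝ) * x 0 + (B' : ℝ)))
      r'.domain →
    Equivalent r r'

/-- **Any proof must use `r.value = r'.value`**: without it the statement is false — witness the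
Fermat cubic against itself with coefficients `a = 1`, `b = 2` (values `ϖ₃ ≠ 2ϖ₃`, and the calculus
is sound, `KZ.Equivalent.value_eq_holds`). [folklore] -/
theorem realPeriodSectorComplete_false_without_valueEq : ¬ RealPeriodSectorCompleteWithoutValueEq := by
  intro h
  have hE := h 0 (-1) 0 (-1) (by norm_num) (by norm_num) 1 2 one_pos two_pos (fermatRep 1)
    (fermatRep 2) (fermatRep_hyps 1).1 (fermatRep_hyps 1).2 (fermatRep_hyps 2).1 (fermatRep_hyps 2).2
  have hv : (fermatRep 1).value = (fermatRep 2).value := Equivalent.value_eq_holds hE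
  rw [value_fermatRep, value_fermatRep] at hv
  have := fermatPeriod_pos
  push_cast at hv
  linarith

/-! ### (2b) `0 < a`, `0 < b` are NOT load-bearing (the sign of the value is the sign of the coefficient) -/

/-- Positive coefficient ⇒ positive value: `{P > 0}` contains the ray `x > |A| + |B| + 1`, of
positive measure, on which `a/√P > 0`; integrability is part of the representation. [folklore] -/
theorem value_pos {A B : ℤ} {a : ℚ} (ha : 0 < a) {r : IntegralRep 1} (hd : r.domain = dom A B)
    (hi : EqOn r.integrand (integrand A B a) r.domain) : 0 < r.value := by
  have hmeas : MeasurableSet r.domain := IntegralRep.measurableSet_domain_holds r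
  unfold IntegralRep.value
  rw [setIntegral_pos_iff_support_of_nonneg_ae ?_ r.integrableOn]
  · set M : ℝ := |(A : ℝ)| + |(B : ℝ)| + 1 with hM
    have hopen : IsOpen {x : Fin 1 → ℝ | M < x 0} := isOpen_lt continuous_const (continuous_apply 0)
    have hne : ({x : Fin 1 → ℝ | M < x 0}).Nonempty := ⟨fun _ => M + 1, by simp⟩
    have hpos : 0 < volume {x : Fin 1 → ℝ | M < x 0} := hopen.measure_pos volume hne
    refine hpos.trans_le (measure_mono fun x hx => ?_)
    have hP : 0 < x 0 ^ 3 + (A : ℝ) * x 0 + (B : ℝ) := cubic_pos_of_lt A B hx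
    have hxd : x ∈ r.domain := by rw [hd]; exact hP
    refine ⟨?_, hxd⟩
    rw [Function.mem_support, hi hxd]
    exact (div_pos (by exact_mod_cast ha) (Real.sqrt_pos.2 hP)).ne'
  · filter_upwards [ae_restrict_mem hmeas] with x hx
    rw [hi hx]
    exact div_nonneg (by exact_mod_cast ha.le) (Real.sqrt_nonneg _)

/-- Zero coefficient ⇒ zero value. [folklore] -/
theorem value_eq_zero {A B : ℤ} {r : IntegralRep 1}
    (hi : EqOn r.integrand (integrand A B 0) r.domain) : r.value = 0 := by
  unfold IntegralRep.value
  rw [setIntegral_congr_fun (IntegralRep.measurableSet_domain_holds r) hi]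
  simp [integrand]

/-- Negative coefficient ⇒ negative value. [folklore] -/
theorem value_neg_of_neg {A B : ℤ} {a : ℚ} (ha : a < 0) {r : IntegralRep 1} (hd : r.domain = dom A B)
    (hi : EqOn r.integrand (integrand A B a) r.domain) : r.value < 0 := by
  have h := value_pos (A := A) (B := B) (a := -a) (by linarith) (r := r.neg) hd (fun x hx => by
    simp only [IntegralRep.integrand_neg, Pi.neg_apply, integrand]
    rw [hi hx, integrand]
    push_cast
    ring)
  rw [IntegralRep.value_neg] at h
  linarith

/-- A representation whose integrand vanishes on its domain is a relation (`[r] − [r] − [r]` is an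
integrand-additivity instance). [folklore] -/
theorem of_mem_relations_of_eqOn_zero {n : ℕ} (r : IntegralRep n) (h : EqOn r.integrand 0 r.domain) :
    KZ.of r ∈ relations := by
  have hmem : KZ.of r - KZ.of r - KZ.of r ∈ integrandAddRel :=
    ⟨n, r, r, r, rfl, rfl, fun x hx => by simp [h hx], rfl⟩
  have h' : -(KZ.of r) ∈ relations := by
    have := integrandAddRel_subset_relations hmem
    rwa [sub_self, zero_sub] at this
  simpa using relations.neg_mem h'

/-- `[r] + [−r]` is a relation (integrand additivity against the zero representation). [folklore] -/
theorem of_add_of_neg_mem_relations {n : ℕ} (r : IntegralRep n) :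
    KZ.of r + KZ.of r.neg ∈ relations := by
  set z : IntegralRep n := r.constMul 0 isAlgebraic_zero with hz_def
  have hz : KZ.of z ∈ relations := of_mem_relations_of_eqOn_zero z (fun x _ => by simp [z])
  have hmem : KZ.of z - KZ.of r - KZ.of r.neg ∈ integrandAddRel :=
    ⟨n, z, r, r.neg, rfl, rfl, fun x _ => by simp [z], rfl⟩
  have := relations.sub_mem hz (integrandAddRel_subset_relations hmem)
  convert this using 1
  abel

/-- Negating both representations does not change equivalence. [folklore] -/
theorem equivalent_neg_iff {n m : ℕ} {r : IntegralRep n} {r' : IntegralRep m} :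
    Equivalent r.neg r'.neg ↔ Equivalent r r' := by
  have h1 := of_add_of_neg_mem_relations r
  have h2 := of_add_of_neg_mem_relations r'
  unfold Equivalent
  constructor
  · intro h
    have := relations.sub_mem (relations.sub_mem h1 h2) h
    convert this using 1
    abel
  · intro h
    have := relations.sub_mem (relations.sub_mem h1 h2) h
    convert this using 1
    abel

/-- Two representations with the same domain whose integrands agree on it are equivalent
(integrand additivity against the zero representation). [folklore] -/
theorem equivalent_of_eqOn {n : ℕ} {r r' : IntegralRep n} (hd : r.domain = r'.domain)
    (hi : EqOn r.integrand r'.integrand r.domain) : Equivalent r r' := by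
  set z : IntegralRep n := r.constMul 0 isAlgebraic_zero with hz_def
  have hz : KZ.of z ∈ relations := of_mem_relations_of_eqOn_zero z (fun x _ => by simp [z])
  have hmem : KZ.of r - KZ.of r' - KZ.of z ∈ integrandAddRel :=
    ⟨n, r, r', z, hd.symm, rfl, fun x hx => by simp [z, hi hx], rfl⟩
  have := relations.add_mem (integrandAddRel_subset_relations hmem) hz
  unfold Equivalent
  convert this using 1
  abel

/-- Under the hypotheses of the crux WITHOUT positivity, value equality forces `a` and `b` to have
the same sign. [folklore] -/
theorem sign_of_value_eq {A B A' B' : ℤ} {a b : ℚ} {r r' : IntegralRep 1} (hd : r.domain = dom A B)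
    (hi : EqOn r.integrand (integrand A B a) r.domain) (hd' : r'.domain = dom A' B')
    (hi' : EqOn r'.integrand (integrand A' B' b) r'.domain) (hv : r.value = r'.value) :
    (0 < a ↔ 0 < b) ∧ (a = 0 ↔ b = 0) := by
  rcases lt_trichotomy 0 a with ha | ha | ha <;> rcases lt_trichotomy 0 b with hb | hb | hb
  · exact ⟨⟨fun _ => hb, fun _ => ha⟩, ⟨fun h => by linarith, fun h => by linarith⟩⟩
  · have h1 := value_pos ha hd hi
    subst hb
    have h2 := value_eq_zero hi'
    linarith
  · have h1 := value_pos ha hd hi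
    have h2 := value_neg_of_neg hb hd' hi'
    linarith
  · subst ha
    have h1 := value_eq_zero hi
    have h2 := value_pos hb hd' hi'
    linarith
  · subst ha; subst hb; simp
  · subst ha
    have h1 := value_eq_zero hi
    have h2 := value_neg_of_neg hb hd' hi'
    linarith
  · have h1 := value_neg_of_neg ha hd hi
    have h2 := value_pos hb hd' hi'
    linarith
  · have h1 := value_neg_of_neg ha hd hi
    subst hb
    have h2 := value_eq_zero hi'
    linarith
  · exact ⟨⟨fun h => by linarith, fun h => by linarith⟩, ⟨fun h => by linarith, fun h => by linarith⟩⟩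

/-- The crux with the hypotheses `0 < a`, `0 < b` DROPPED (all rational coefficients). -/
def RealPeriodSectorCompleteWithoutPos : Prop :=
  ∀ (A B A' B' : ℤ), 4 * A ^ 3 + 27 * B ^ 2 ≠ 0 → 4 * A' ^ 3 + 27 * B' ^ 2 ≠ 0 → ∀ (a b : ℚ),
    ∀ (r r' : IntegralRep 1),
    r.domain = {x | 0 < x 0 ^ 3 + (A : ℝ) * x 0 + (B : ℝ)} →
    EqOn r.integrand (fun x => (a : ℝ) / Real.sqrt (x 0 ^ 3 + (A : ℝ) * x 0 + (B : ℝ))) r.domain →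
    r'.domain = {x | 0 < x 0 ^ 3 + (A' : ℝ) * x 0 + (B' : ℝ)} →
    EqOn r'.integrand (fun x => (b : ℝ) / Real.sqrt (x 0 ^ 3 + (A' : ℝ) * x 0 + (B' : ℝ)))
      r'.domain →
    r.value = r'.value → Equivalent r r'

/-- **The positivity hypotheses are cosmetic**: the crux is EQUIVALENT to its version over all
rational `a`, `b`. Value equality forces `sign a = sign b` (`sign_of_value_eq`); `a = b = 0` gives
two relations; `a, b < 0` is the positive case for the negated representations
(`equivalent_neg_iff`). So `0 < a`, `0 < b` carry no information a prover could exploit. [folklore] -/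
theorem realPeriodSectorComplete_iff_withoutPos :
    RealPeriodSectorComplete ↔ RealPeriodSectorCompleteWithoutPos := by
  constructor
  · intro h A B A' B' hΔ hΔ' a b r r' hd hi hd' hi' hv
    obtain ⟨hpos, hzero⟩ := sign_of_value_eq (A := A) (B := B) (A' := A') (B' := B') hd hi hd' hi' hv
    rcases lt_trichotomy 0 a with ha | ha | ha
    · exact h A B A' B' hΔ hΔ' a b ha (hpos.1 ha) r r' hd hi hd' hi' hv
    · have hb : b = 0 := hzero.1 ha.symm
      subst hb
      have hr : KZ.of r ∈ relations := of_mem_relations_of_eqOn_zero r (fun x hx => by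
        rw [hi hx, ← ha]; simp)
      have hr' : KZ.of r' ∈ relations := of_mem_relations_of_eqOn_zero r' (fun x hx => by
        rw [hi' hx]; simp)
      exact relations.sub_mem hr hr'
    · have hb : b < 0 := by
        rcases lt_trichotomy 0 b with hb | hb | hb
        · exact absurd (hpos.2 hb) (by linarith)
        · exact absurd (hzero.2 hb.symm) (by linarith)
        · exact hb
      have hE := h A B A' B' hΔ hΔ' (-a) (-b) (by linarith) (by linarith) r.neg r'.neg hd
        (fun x hx => by
          simp only [IntegralRep.integrand_neg, Pi.neg_apply]
          rw [hi hx]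
          push_cast
          ring)
        hd'
        (fun x hx => by
          simp only [IntegralRep.integrand_neg, Pi.neg_apply]
          rw [hi' hx]
          push_cast
          ring)
        (by rw [IntegralRep.value_neg, IntegralRep.value_neg, hv])
      exact equivalent_neg_iff.1 hE
  · intro h A B A' B' hΔ hΔ' a b _ _ r r' hd hi hd' hi' hv
    exact h A B A' B' hΔ hΔ' a b r r' hd hi hd' hi' hv

/-! ## §3 Tightness: the diagonal of the crux, and the exact class structure on one curve -/

/-- On the Fermat cubic the KZ-classes are EXACTLY the coefficients:
`[σ, a/√P] ~ [σ, b/√P] ↔ a = b` (→ soundness and `ϖ₃ ≠ 0`; ← reflexivity). [folklore] -/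
theorem equivalent_fermatRep_iff (a b : ℚ) : Equivalent (fermatRep a) (fermatRep b) ↔ a = b := by
  constructor
  · intro h
    have hv := Equivalent.value_eq_holds h
    rw [value_fermatRep, value_fermatRep] at hv
    exact_mod_cast mul_right_cancel₀ fermatPeriod_pos.ne' hv
  · rintro rfl
    exact Equivalent.refl _

/-- **The diagonal `(A, B) = (A′, B′)` of the crux is a theorem** (one integrand-additivity move):
value equality forces `a = b` (scale `r` by `b/a` and compare values), and then the two
representations have the same domain and the same integrand on it. So the content of the crux is
entirely off-diagonal. [folklore] -/
theorem realPeriodSectorComplete_diag (A B : ℤ) {a b : ℚ} (ha : a ≠ 0) (r r' : IntegralRep 1)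
    (hd : r.domain = dom A B) (hi : EqOn r.integrand (integrand A B a) r.domain)
    (hd' : r'.domain = dom A B) (hi' : EqOn r'.integrand (integrand A B b) r'.domain)
    (hv : r.value = r'.value) : Equivalent r r' := by
  have halg : IsAlgebraic ℚ (((b / a : ℚ)) : ℝ) := by
    simpa using isAlgebraic_algebraMap (R := ℚ) (A := ℝ) (b / a)
  set r₂ : IntegralRep 1 := r.constMul ((b / a : ℚ) : ℝ) halg with hr₂
  have hdd : r.domain = r'.domain := hd.trans hd'.symm
  have h₂ : Equivalent r₂ r' := equivalent_of_eqOn hdd (fun x hx => by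
    have hx' : x ∈ r'.domain := hdd ▸ hx
    simp only [hr₂, IntegralRep.integrand_constMul]
    rw [hi hx, hi' hx', integrand, integrand]
    push_cast
    field_simp)
  have hv₂ : r₂.value = r'.value := Equivalent.value_eq_holds h₂
  rw [hr₂, IntegralRep.value_constMul, ← hv] at hv₂
  have hr0 : r.value ≠ 0 := by
    rcases lt_or_gt_of_ne ha with ha' | ha'
    · exact (value_neg_of_neg ha' hd hi).ne
    · exact (value_pos ha' hd hi).ne'
  have hba : ((b / a : ℚ) : ℝ) = 1 := by
    have := mul_right_cancel₀ hr0 (hv₂.trans (one_mul _).symm)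
    exact this
  have hab : b = a := by
    have : (b / a : ℚ) = 1 := by exact_mod_cast hba
    field_simp at this
    linarith
  subst hab
  exact equivalent_of_eqOn hdd (fun x hx => by rw [hi hx, hi' (hdd ▸ hx)])


/-! ## §5 The discriminant hypothesis: the most degenerate excluded instance is VACUOUS

Dropping `4A³ + 27B² ≠ 0` admits singular `P`. At the cusp `A = B = 0` (`P = x³`) the hypotheses
of the crux cannot even be instantiated: `a/√(x³) = a·x^{-3/2}` is not integrable on
`{x³ > 0} = (0, ∞)`, and integrability is a field of `IntegralRep`. (The nodes `P = (x−e)²(x+2e)`,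
`e ∈ ℤ`: `e > 0` is likewise vacuous — `1/|x−e|` at the double root —, `e < 0` gives the genus-0 value
`a·π/√(3|e|)`; see the module docstring, item 3.) -/

/-- `{x³ > 0} = {x > 0}` in `ℝ¹`. [folklore] -/
theorem dom_cusp_eq : dom 0 0 = (MeasurableEquiv.funUnique (Fin 1) ℝ) ⁻¹' Ioi 0 := by
  ext x
  simp only [dom, Int.cast_zero, zero_mul, add_zero, mem_setOf_eq, mem_preimage, mem_Ioi,
    funUnique_apply_eq]
  exact (by decide : Odd 3).pow_pos_iff

/-- **The cusp is vacuous**: no integral representation has domain `{x³ > 0}` and integrand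
`a/√(x³)` on it (`a ≠ 0`), because `x^{-3/2}` is not integrable on `(0, ∞)`
(`not_integrableOn_Ioi_rpow`). [folklore] -/
theorem no_rep_cusp {a : ℚ} (ha : a ≠ 0) :
    ¬ ∃ r : IntegralRep 1, r.domain = {x | 0 < x 0 ^ 3 + ((0 : ℤ) : ℝ) * x 0 + ((0 : ℤ) : ℝ)} ∧
      EqOn r.integrand (fun x => (a : ℝ) / Real.sqrt (x 0 ^ 3 + ((0 : ℤ) : ℝ) * x 0 + ((0 : ℤ) : ℝ)))
        r.domain := by
  rintro ⟨r, hd, hi⟩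
  have hd' : r.domain = (MeasurableEquiv.funUnique (Fin 1) ℝ) ⁻¹' Ioi 0 := by
    rw [hd]; exact dom_cusp_eq
  -- the integrand, transported to `ℝ`
  have h1 : IntegrableOn (fun x : Fin 1 → ℝ => (a : ℝ) / Real.sqrt (x 0 ^ 3)) r.domain := by
    refine r.integrableOn.congr_fun (fun x hx => ?_) (IntegralRep.measurableSet_domain_holds r)
    rw [hi hx]
    simp
  have h2 : IntegrableOn ((fun t : ℝ => (a : ℝ) / Real.sqrt (t ^ 3)) ∘
      (MeasurableEquiv.funUnique (Fin 1) ℝ)) ((MeasurableEquiv.funUnique (Fin 1) ℝ) ⁻¹' Ioi 0) := by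
    rw [← hd']
    exact h1
  have h3 : IntegrableOn (fun t : ℝ => (a : ℝ) / Real.sqrt (t ^ 3)) (Ioi 0) :=
    ((volume_preserving_funUnique (Fin 1) ℝ).integrableOn_comp_preimage
      (MeasurableEquiv.measurableEmbedding _)).1 h2
  have h4 : IntegrableOn (fun t : ℝ => t ^ (-(3 / 2 : ℝ))) (Ioi 0) := by
    have h : IntegrableOn (fun t : ℝ => (a : ℝ)⁻¹ * ((a : ℝ) / Real.sqrt (t ^ 3))) (Ioi 0) :=
      h3.const_mul ((a : ℝ)⁻¹)
    refine h.congr_fun (fun t ht => ?_) measurableSet_Ioi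
    have ht0 : 0 < t := ht
    have ha' : (a : ℝ) ≠ 0 := by exact_mod_cast ha
    have hsq : Real.sqrt (t ^ 3) = t ^ (3 / 2 : ℝ) := by
      rw [Real.sqrt_eq_rpow, ← Real.rpow_natCast, ← Real.rpow_mul ht0.le]
      norm_num
    show (a : ℝ)⁻¹ * ((a : ℝ) / Real.sqrt (t ^ 3)) = t ^ (-(3 / 2 : ℝ))
    rw [hsq, Real.rpow_neg ht0.le]
    field_simp
  exact not_integrableOn_Ioi_rpow _ h4


end Summit.KontsevichZagierPeriods.IsogenyCertificates.RealPeriodSectorCompleteNegative
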